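import Summits.Langlands.Langlands.Theorems.SqrtFiveQuarticCoversCertB3E7
import Mathlib.AlgebraicGeometry.EllipticCurve.Affine.Point

/-!
# Route `Langlands/SqrtFiveQuarticCovers`, certificate `CertB3E7` (sheet 4.5 `X(b3,H12,e7)`;
# stmt-Langlands-23416) — the named input NF-E10-MW (`hE49`, stub `MordellWeilE7`) DERIVED in the
# kernel from the Mordell–Weil datum alone, via Mathlib's group law

In `Theorems/SqrtFiveQuarticCoversCertB3E7.lean` (p670569, typ-2) the hypothesis `hE49` (registered
stub `MordellWeilE7` of the child item) reads: «for `K` quartic, `r² = 5`, `σ ≠ id` a ring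
endomorphism of `K` fixing `r`, and `(x, y) ∈ K²` with `y² = 7q(x)`,
`q = 16x⁴ + 68x³ + 111x² + 62x + 11` (FLS Lemma 4.2's model of `X(e7)`): `σx = x` or
`(12x + 5)·σx = −(5x + 2)`» — i.e. the Mordell–Weil datum `X(e7)(ℚ(√5)) = {(−1/3, ±14/9)}` WITH
«the group law read on `x`» folded in (`Q + Q^σ ∈ {O, T₀}`, `x(T₀ − Q) = x(Q)`, `x(−Q) = m(x(Q))`).
This file PROVES that statement (`mordellWeilE7_of_fixedPoints`, type = the stub's signature
verbatim) from the WEAKER named input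

* `hMW` «**`W(K)^σ = {O, T}`**»: for `K`, `r`, `σ` as above and `X Y : K` with `σX = X`, `σY = Y`
  and `Y² = X³ + 294X² − 343X`: `X = 0 ∧ Y = 0` — the `σ`-fixed (i.e. `ℚ(√5)`-rational, `K^σ =
  ℚ(r)`) affine points of the Weierstrass model `W : Y² = X³ + 294X² − 343X` of `X(e7)` are the
  single point `T = (0, 0)`.  This is EXACTLY the certified finite datum «`49a4(ℚ(√5)) ≅ ℤ/2`»:
  `W ≅ 49a4 = [1, −1, 0, −1822, 30393]` over `ℚ` by `(u, r, s, t) = (2, −99, 1, 0)` (so `T ↦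
  (99/4, −99/8)`, certnum's generator), rank `0` over `k = ℚ(√5)` from `L(49a,1)·L(49a ⊗ χ₅, 1) ≠ 0`
  EXACTLY (certnum RELEASES l.140, RQ-027 K1 LV0; eng-8 j313052; eng-3 exact modular symbols) +
  Kolyvagin–Logachev (NAMED print fact) + torsion `ℤ/2` (l.140 K2 TORE); nothing about the quartic
  model, no group law in the hypothesis.

and Mathlib's group law (`WeierstrassCurve.Affine.Point`, an `AddCommGroup`; `Point.map σ` a group
homomorphism).  THE MAP (Riemann–Roch at `O = (−1/3, 14/9)`; typ-1 `HOME/lg-quartmod-typ-1/e7mw/`,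
sympy, exact): `N := 35x² + 98x + 4y + 35`, `φ(x, y) = (X, Y) = (7N/(3x+1)², 196(2x+1)N/(3x+1)³)`,
`φ(O) = O_W`, `φ(−1/3, −14/9) = T`.  Kernel facts: (I1) `φ` lands on `W` (`e7_phi_on_W`); (I2) KEY
RATIO `Y·(3x+1) = 28(2x+1)·X` (`e7_phi_ratio`: `x` is a Möbius function of `Y/X`); (I5) `N ≠ 0` off
`x = −1/3` (`e7_N_ne_zero`).  ARGUMENT: `P := φ(x,y)`, `S := P + σP` is `σ`-fixed (`σ ∘ σ = id`,
`ringHom_apply_apply_of_fixing_sqrt_five`: `[K : ℚ(r)] = 2`, Galois) ⇒ `S ∈ {O, T}` by `hMW`;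
`S = O` ⇒ `σP = −P = (X, −Y)` ⇒ `(12x+5)σx = −(5x+2)` (`e7_caseA`); `S = T` ⇒ `σP = T + (−P)`
(Mathlib's chord through `T`) ⇒ `σX·X = −343`, `σY·X = Y·σX` ⇒ `σx = x` (`e7_caseB`); `x = −1/3`
itself is `σ`-fixed.  No inverse map and no injectivity lemma are needed.

* `certB3E7_of_modelIdentification_of_fixedPoints_of_census (hK1) (hMW) (hZmm) (hZmi) :
  …Theses…CertB3E7` — the route child BY NAME with `hE49` replaced by `hMW` (via typ-2's `certB3E7`).
* anchor `e7_W_variableChange_49a4` — the `(u,r,s,t) = (2, −99, 1, 0)` identities taking `W` to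
  `[1, −1, 0, −1822, 30393]` (so the datum is about Cremona/LMFDB `49a4` exactly).

HONEST STATUS: CONDITIONAL bookkeeping + Mathlib's group law on ONE explicit elliptic curve; the
Mordell–Weil datum (rank `0` via exact `L`-values + Kolyvagin–Logachev, torsion `ℤ/2`) stays a
NAMED certified input; nothing here proves modularity of any curve; «a certified finite datum is not
a modularity statement».  References: [FreitasLeHungSiksek2015] Lemma 4.2 (arXiv:1310.7088 p. 28);
cell records CENSUS.md §15 row 4.5, NAMED-INPUT-TABLE.md row 2 (E7-MW-GROUPLAW).
-/

noncomputable section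

set_option linter.dupNamespace false -- project-wide option; `Summit.Langlands.Langlands` is the mandated namespace

open scoped MatrixGroups NumberField Matrix Polynomial IntermediateField
open NumberField Polynomial
open Literature.NumberTheory.Automorphic Summit.Langlands.Langlands.Theses.SqrtFiveQuarticCovers

namespace Summit.Langlands.Langlands.Theorems.SqrtFiveQuarticCovers

/-! ### §1 `σ ∘ σ = id` for a ring endomorphism of a quartic field fixing `√5` -/

/-- If `K` is a quartic number field, `r ∈ K` with `r² = 5`, and `σ : K →+* K` fixes `r`, then
`σ ∘ σ = id`: `σ` fixes `ℚ(r)` pointwise, `[K : ℚ(r)] = 2`, so `σ` is an element of the Galois group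
of the quadratic (hence Galois) extension `K/ℚ(r)`, a group of order `2`. [folklore] -/
theorem ringHom_apply_apply_of_fixing_sqrt_five {K : Type} [Field K] [NumberField K]
    (hd : Module.finrank ℚ K = 4) {r : K} (hr : r ^ 2 = 5) (σ : K →+* K) (hσr : σ r = r)
    (z : K) : σ (σ z) = z := by
  have hr_int : IsIntegral ℚ r := Algebra.IsIntegral.isIntegral r
  have hF2 : Module.finrank ℚ ℚ⟮r⟯ = 2 := by
    rw [IntermediateField.adjoin.finrank hr_int, minpoly_eq_X_sq_sub_five hr, natDegree_X_pow_sub_C]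
  have hFK : Module.finrank ℚ⟮r⟯ K = 2 := by
    have h := Module.finrank_mul_finrank ℚ ℚ⟮r⟯ K
    rw [hF2, hd] at h
    omega
  haveI : Algebra.IsQuadraticExtension ℚ⟮r⟯ K := ⟨hFK⟩
  haveI : IsGalois ℚ⟮r⟯ K := inferInstance
  have hcard : Nat.card (K ≃ₐ[ℚ⟮r⟯] K) = 2 := by
    rw [IsGalois.card_aut_eq_finrank, hFK]
  have hfixF : ∀ w : ℚ⟮r⟯, σ (w : K) = w := by
    intro w
    obtain ⟨a, b, hab⟩ := exists_rat_add_rat_mul_of_mem_adjoin_sqrt_five hr w.2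
    rw [hab, map_add, map_mul, map_ratCast, map_ratCast, hσr]
  let σF : K →ₐ[ℚ⟮r⟯] K :=
    { σ with commutes' := fun w => hfixF w }
  let σE : K ≃ₐ[ℚ⟮r⟯] K :=
    AlgEquiv.ofBijective σF (Algebra.IsAlgebraic.algHom_bijective σF)
  have h2 : σE ^ Nat.card (K ≃ₐ[ℚ⟮r⟯] K) = 1 := pow_card_eq_one'
  rw [hcard, pow_two] at h2
  have h := congrArg (fun e : K ≃ₐ[ℚ⟮r⟯] K => e z) h2
  simpa [σE, σF] using h

/-! ### §2 The map `φ : (x, y) ↦ (X, Y)` from FLS's quartic model of `X(e7)` to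
`W : Y² = X³ + 294X² − 343X` — elementary identities -/

section PhiAlgebra

variable {K : Type*} [Field K]

/-- `16·7q(x) − (35x² + 98x + 35)² = 7(3x + 1)⁴`. [folklore] -/
theorem e7_sixteen_mul_sub_sq (x : K) :
    16 * (7 * (16 * x ^ 4 + 68 * x ^ 3 + 111 * x ^ 2 + 62 * x + 11)) - (35 * x ^ 2 + 98 * x + 35) ^ 2
      = 7 * (3 * x + 1) ^ 4 := by
  ring

/-- Off `x = −1/3`, `N = 35x² + 98x + 4y + 35 ≠ 0` on `y² = 7q(x)` (else `7(3x+1)⁴ = 0`); i.e. the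
only affine point of the quartic model mapped to `T = (0,0)` is `(−1/3, −14/9)`. [folklore] -/
theorem e7_N_ne_zero [CharZero K] {x y : K}
    (hy : y ^ 2 = 7 * (16 * x ^ 4 + 68 * x ^ 3 + 111 * x ^ 2 + 62 * x + 11)) (h3 : 3 * x + 1 ≠ 0) :
    35 * x ^ 2 + 98 * x + 4 * y + 35 ≠ 0 := by
  intro hN
  have h7 : 7 * (3 * x + 1) ^ 4 = 0 := by
    linear_combination (-16) * hy - (35 * x ^ 2 + 98 * x - 4 * y + 35) * hN
  have : (3 * x + 1) ^ 4 = 0 := by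
    have h7' : (7 : K) ≠ 0 := by norm_num
    exact (mul_eq_zero.mp h7).resolve_left h7'
  exact h3 (pow_eq_zero_iff (by norm_num) |>.mp this)

/-- (I1) `φ(x, y) = (7N/(3x+1)², 196(2x+1)N/(3x+1)³)` lands on `W : Y² = X³ + 294X² − 343X`.
[folklore] -/
theorem e7_phi_on_W {x y : K}
    (hy : y ^ 2 = 7 * (16 * x ^ 4 + 68 * x ^ 3 + 111 * x ^ 2 + 62 * x + 11)) (h3 : 3 * x + 1 ≠ 0) :
    (196 * (2 * x + 1) * (35 * x ^ 2 + 98 * x + 4 * y + 35) / (3 * x + 1) ^ 3) ^ 2 =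
      (7 * (35 * x ^ 2 + 98 * x + 4 * y + 35) / (3 * x + 1) ^ 2) ^ 3
        + 294 * (7 * (35 * x ^ 2 + 98 * x + 4 * y + 35) / (3 * x + 1) ^ 2) ^ 2
        - 343 * (7 * (35 * x ^ 2 + 98 * x + 4 * y + 35) / (3 * x + 1) ^ 2) := by
  set N := 35 * x ^ 2 + 98 * x + 4 * y + 35 with hN
  set X := 7 * N / (3 * x + 1) ^ 2 with hX
  set Y := 196 * (2 * x + 1) * N / (3 * x + 1) ^ 3 with hY
  have hX' : X * (3 * x + 1) ^ 2 = 7 * N := div_mul_cancel₀ _ (pow_ne_zero 2 h3)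
  have hY' : Y * (3 * x + 1) ^ 3 = 196 * (2 * x + 1) * N := div_mul_cancel₀ _ (pow_ne_zero 3 h3)
  have key : (196 * (2 * x + 1) * N) ^ 2 =
      (7 * N) ^ 3 + 294 * (7 * N) ^ 2 * (3 * x + 1) ^ 2 - 343 * (7 * N) * (3 * x + 1) ^ 4 := by
    rw [hN]; linear_combination (-5488 * (35 * x ^ 2 + 98 * x + 4 * y + 35)) * hy
  apply mul_right_cancel₀ (pow_ne_zero 6 h3)
  calc Y ^ 2 * (3 * x + 1) ^ 6 = (Y * (3 * x + 1) ^ 3) ^ 2 := by ring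
    _ = (196 * (2 * x + 1) * N) ^ 2 := by rw [hY']
    _ = (7 * N) ^ 3 + 294 * (7 * N) ^ 2 * (3 * x + 1) ^ 2 - 343 * (7 * N) * (3 * x + 1) ^ 4 := key
    _ = (X * (3 * x + 1) ^ 2) ^ 3 + 294 * (X * (3 * x + 1) ^ 2) ^ 2 * (3 * x + 1) ^ 2
          - 343 * (X * (3 * x + 1) ^ 2) * (3 * x + 1) ^ 4 := by rw [hX']
    _ = (X ^ 3 + 294 * X ^ 2 - 343 * X) * (3 * x + 1) ^ 6 := by ring

/-- (I2) The key ratio: `Y·(3x + 1) = 28(2x + 1)·X` for `(X, Y) = φ(x, y)` — so that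
`x = (28X − Y)/(3Y − 56X)` is a Möbius function of `Y/X`. [folklore] -/
theorem e7_phi_ratio (x y : K) :
    196 * (2 * x + 1) * (35 * x ^ 2 + 98 * x + 4 * y + 35) / (3 * x + 1) ^ 3 * (3 * x + 1) =
      28 * (2 * x + 1) * (7 * (35 * x ^ 2 + 98 * x + 4 * y + 35) / (3 * x + 1) ^ 2) := by
  field_simp
  ring

/-- Case A (`σP = −P`): from `Y(3x+1) = 28(2x+1)X`, `(−Y)(3a+1) = 28(2a+1)X` and `X ≠ 0`:
`(12x + 5)·a = −(5x + 2)`. [folklore] -/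
theorem e7_caseA [CharZero K] {x a X Y : K} (hX : X ≠ 0)
    (h1 : Y * (3 * x + 1) = 28 * (2 * x + 1) * X) (h2 : -Y * (3 * a + 1) = 28 * (2 * a + 1) * X) :
    (12 * x + 5) * a = -(5 * x + 2) := by
  have h : 28 * X * ((2 * a + 1) * (3 * x + 1) + (2 * x + 1) * (3 * a + 1)) = 0 := by
    linear_combination -(3 * x + 1) * h2 - (3 * a + 1) * h1
  have h28 : (28 : K) * X ≠ 0 := mul_ne_zero (by norm_num) hX
  have h' := (mul_eq_zero.mp h).resolve_left h28
  linear_combination h'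

/-- Case B (`σP = T − P`): from `Y(3x+1) = 28(2x+1)X`, `Y'(3a+1) = 28(2a+1)X'`, `Y'·X = Y·X'`
and `X, X' ≠ 0`: `a = x`. [folklore] -/
theorem e7_caseB [CharZero K] {x a X Y X' Y' : K} (hX : X ≠ 0) (hX' : X' ≠ 0)
    (h1 : Y * (3 * x + 1) = 28 * (2 * x + 1) * X) (h2 : Y' * (3 * a + 1) = 28 * (2 * a + 1) * X')
    (h3 : Y' * X = Y * X') : a = x := by
  -- `Y(3a+1) = 28(2a+1)X`
  have h4 : X' * (Y * (3 * a + 1) - 28 * (2 * a + 1) * X) = 0 := by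
    linear_combination X * h2 - (3 * a + 1) * h3
  have h4' := (mul_eq_zero.mp h4).resolve_left hX'
  -- subtract from `h1`: `(a − x)(3Y − 56X) = 0`
  have h5 : (a - x) * (3 * Y - 56 * X) = 0 := by linear_combination h4' - h1
  rcases mul_eq_zero.mp h5 with h | h
  · linear_combination h
  · -- `3Y = 56X` contradicts the ratio: `56X(3x+1) = 84(2x+1)X` ⇒ `28X = 0`
    exfalso
    have h6 : 28 * X = 0 := by linear_combination (3 * x + 1) * h - 3 * h1
    exact mul_ne_zero (by norm_num) hX h6

end PhiAlgebra

/-! ### §3 The Weierstrass curve `W = [0, 294, 0, −343, 0]` over `K`: equation, negation, chord -/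

section CurveW

open WeierstrassCurve WeierstrassCurve.Affine

variable {K : Type} [Field K] [CharZero K]

/-- Affine equation of `W⁄K`, `W = [0, 294, 0, −343, 0]`: `v² = u³ + 294u² − 343u`. [folklore] -/
theorem e7W_equation_iff (u v : K) :
    (WeierstrassCurve.Affine.baseChange (⟨0, 294, 0, -343, 0⟩ : WeierstrassCurve.Affine ℚ) K).Equation u v ↔
      v ^ 2 = u ^ 3 + 294 * u ^ 2 - 343 * u := by
  rw [WeierstrassCurve.Affine.equation_iff]
  simp [WeierstrassCurve.Affine.baseChange, WeierstrassCurve.baseChange]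
  constructor <;> intro h <;> linear_combination h

/-- `Δ(W) = 2¹²·7⁹ ≠ 0`. [folklore] -/
theorem e7W_Δ_ne_zero :
    (WeierstrassCurve.Affine.baseChange (⟨0, 294, 0, -343, 0⟩ : WeierstrassCurve.Affine ℚ) K).Δ ≠ 0 := by
  simp [WeierstrassCurve.Affine.baseChange, WeierstrassCurve.baseChange, WeierstrassCurve.Δ,
    WeierstrassCurve.b₂, WeierstrassCurve.b₄, WeierstrassCurve.b₆, WeierstrassCurve.b₈]
  norm_num

/-- Every affine point of the elliptic curve `W⁄K` is nonsingular. [folklore] -/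
theorem e7W_nonsingular {u v : K} (h : v ^ 2 = u ^ 3 + 294 * u ^ 2 - 343 * u) :
    (WeierstrassCurve.Affine.baseChange (⟨0, 294, 0, -343, 0⟩ : WeierstrassCurve.Affine ℚ) K).Nonsingular u v :=
  (WeierstrassCurve.Affine.equation_iff_nonsingular_of_Δ_ne_zero e7W_Δ_ne_zero).mp
    ((e7W_equation_iff u v).mpr h)

/-- Negation on `W⁄K`: `−(u, v) = (u, −v)` (`a₁ = a₃ = 0`). [folklore] -/
theorem e7W_negY (u v : K) :
    (WeierstrassCurve.Affine.baseChange (⟨0, 294, 0, -343, 0⟩ : WeierstrassCurve.Affine ℚ) K).negY u v = -v := by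
  simp [WeierstrassCurve.Affine.negY, WeierstrassCurve.Affine.baseChange, WeierstrassCurve.baseChange]

/-- The chord `X`-coordinate on `W⁄K`: `addX u₁ u₂ ℓ = ℓ² − 294 − u₁ − u₂`. [folklore] -/
theorem e7W_addX (u₁ u₂ ℓ : K) :
    (WeierstrassCurve.Affine.baseChange (⟨0, 294, 0, -343, 0⟩ : WeierstrassCurve.Affine ℚ) K).addX u₁ u₂ ℓ =
      ℓ ^ 2 - 294 - u₁ - u₂ := by
  simp [WeierstrassCurve.Affine.addX, WeierstrassCurve.Affine.baseChange, WeierstrassCurve.baseChange]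

/-- The chord `Y`-coordinate on `W⁄K`: `addY u₁ u₂ v₁ ℓ = −(ℓ(addX − u₁) + v₁)`. [folklore] -/
theorem e7W_addY (u₁ u₂ v₁ ℓ : K) :
    (WeierstrassCurve.Affine.baseChange (⟨0, 294, 0, -343, 0⟩ : WeierstrassCurve.Affine ℚ) K).addY u₁ u₂ v₁ ℓ =
      -(ℓ * (ℓ ^ 2 - 294 - u₁ - u₂ - u₁) + v₁) := by
  simp [WeierstrassCurve.Affine.addY, WeierstrassCurve.Affine.negAddY, WeierstrassCurve.Affine.addX,
    WeierstrassCurve.Affine.negY, WeierstrassCurve.Affine.baseChange, WeierstrassCurve.baseChange]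

end CurveW

/-! ### §4 `MordellWeilE7` (= `hE49` of `certB3E7`) from the fixed-point datum `W(K)^σ = {O, T}` -/

/-- **NF-E10-MW derived: the type of the registered stub `MordellWeilE7` (hypothesis `hE49` of
`certB3E7`, p670569) VERBATIM, from the Mordell–Weil datum in fixed-point form.**  `hMW` «`K` quartic,
`r² = 5`, `σ : K →+* K` with `σ r = r`, `σ ≠ id`: every `σ`-fixed affine `K`-point of
`W : Y² = X³ + 294X² − 343X` is `T = (0,0)`» (= `W(ℚ(√5)) = {O, T}`, `W ≅_ℚ 49a4`; certnum RELEASES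
l.140 K1 LV0 + K2 TORE; rank `0` via Kolyvagin–Logachev NAMED).  Proof: the module docstring's
ARGUMENT. [cite: FreitasLeHungSiksek2015, Lemma 4.2 (arXiv:1310.7088 p. 28)] -/
theorem mordellWeilE7_of_fixedPoints
    (hMW : ∀ (K : Type) [Field K] [NumberField K], Module.finrank ℚ K = 4 → ∀ r : K, r ^ 2 = 5 →
        ∀ σ : K →+* K, σ r = r → σ ≠ RingHom.id K →
          ∀ X Y : K, σ X = X → σ Y = Y → Y ^ 2 = X ^ 3 + 294 * X ^ 2 - 343 * X → X = 0 ∧ Y = 0) :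
    ∀ (K : Type) [Field K] [NumberField K], Module.finrank ℚ K = 4 → ∀ r : K, r ^ 2 = 5 →
        ∀ σ : K →+* K, σ r = r → σ ≠ RingHom.id K →
          ∀ x y : K, y ^ 2 = 7 * (16 * x ^ 4 + 68 * x ^ 3 + 111 * x ^ 2 + 62 * x + 11) → (σ x = x ∨ (12 * x + 5) * σ x = -(5 * x + 2)) := by
  intro K _ _ hd r hr σ hσr hσ x y hy
  classical
  -- the `ℚ`-rational fibre `x = −1/3` is fixed by `σ`
  by_cases h3 : 3 * x + 1 = 0
  · left
    have hx : x = ((-1/3 : ℚ) : K) := by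
      push_cast; linear_combination h3 / 3
    rw [hx, map_ratCast]
  have hσσ : ∀ z, σ (σ z) = z := ringHom_apply_apply_of_fixing_sqrt_five hd hr σ hσr
  -- the affine point `P = φ(x, y)` of `W⁄K`
  set N : K := 35 * x ^ 2 + 98 * x + 4 * y + 35 with hN
  set X : K := 7 * N / (3 * x + 1) ^ 2 with hXdef
  set Y : K := 196 * (2 * x + 1) * N / (3 * x + 1) ^ 3 with hYdef
  have hN0 : N ≠ 0 := e7_N_ne_zero hy h3
  have hX0 : X ≠ 0 := by
    rw [hXdef]
    exact div_ne_zero (mul_ne_zero (by norm_num) hN0) (pow_ne_zero 2 h3)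
  have hW : Y ^ 2 = X ^ 3 + 294 * X ^ 2 - 343 * X := e7_phi_on_W hy h3
  have hratio : Y * (3 * x + 1) = 28 * (2 * x + 1) * X := e7_phi_ratio x y
  have hratioσ : σ Y * (3 * σ x + 1) = 28 * (2 * σ x + 1) * σ X := by
    have h := congrArg σ hratio
    simp only [map_mul, map_add, map_ofNat, map_one] at h
    exact h
  -- points of `W⁄K`
  set P : (WeierstrassCurve.Affine.baseChange (⟨0, 294, 0, -343, 0⟩ : WeierstrassCurve.Affine ℚ) K).Point :=
    WeierstrassCurve.Affine.Point.some X Y (e7W_nonsingular hW) with hP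
  set T : (WeierstrassCurve.Affine.baseChange (⟨0, 294, 0, -343, 0⟩ : WeierstrassCurve.Affine ℚ) K).Point :=
    WeierstrassCurve.Affine.Point.some 0 0 (e7W_nonsingular (by ring)) with hT
  let σ' : K →ₐ[ℚ] K := σ.toRatAlgHom
  have hσ' : ∀ z, σ' z = σ z := fun z => rfl
  -- `Point.map σ'` is an involution
  have hmapmap : ∀ Q : (WeierstrassCurve.Affine.baseChange (⟨0, 294, 0, -343, 0⟩ : WeierstrassCurve.Affine ℚ) K).Point,
      WeierstrassCurve.Affine.Point.map σ' (WeierstrassCurve.Affine.Point.map σ' Q) = Q := by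
    rintro (_ | ⟨a, b, h⟩)
    · rfl
    · simp only [WeierstrassCurve.Affine.Point.map_some]
      congr 1 <;> exact hσσ _
  -- the image of `P` under `σ`
  have hmapP : WeierstrassCurve.Affine.Point.map σ' P =
      WeierstrassCurve.Affine.Point.some (σ X) (σ Y)
        (e7W_nonsingular (by
          have h := congrArg σ hW
          simp only [map_pow, map_add, map_sub, map_mul, map_ofNat] at h
          exact h)) := by
    rw [hP, WeierstrassCurve.Affine.Point.map_some]
    rfl
  -- `S = P + σP` is `σ`-fixed, hence `0` or `T`
  have hSfix : WeierstrassCurve.Affine.Point.map σ' (P + WeierstrassCurve.Affine.Point.map σ' P) =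
      P + WeierstrassCurve.Affine.Point.map σ' P := by
    rw [map_add, hmapmap, add_comm]
  have hS0T : P + WeierstrassCurve.Affine.Point.map σ' P = 0 ∨
      P + WeierstrassCurve.Affine.Point.map σ' P = T := by
    rcases hScase : P + WeierstrassCurve.Affine.Point.map σ' P with _ | ⟨a, b, h⟩
    · exact Or.inl rfl
    · right
      rw [hScase, WeierstrassCurve.Affine.Point.map_some] at hSfix
      obtain ⟨ha, hb⟩ := WeierstrassCurve.Affine.Point.some.inj hSfix
      have hab : b ^ 2 = a ^ 3 + 294 * a ^ 2 - 343 * a := (e7W_equation_iff a b).mp h.1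
      obtain ⟨ha0, hb0⟩ := hMW K hd r hr σ hσr hσ a b ha hb hab
      subst ha0 hb0
      rw [hT]
  rcases hS0T with h0 | hTcase
  · -- Case A: `σP = −P`, i.e. `σX = X`, `σY = −Y`
    right
    have hneg : WeierstrassCurve.Affine.Point.map σ' P = -P := (add_eq_zero_iff_neg_eq.mp h0).symm
    rw [hmapP, hP, WeierstrassCurve.Affine.Point.neg_some] at hneg
    obtain ⟨hσX, hσY⟩ := WeierstrassCurve.Affine.Point.some.inj hneg
    rw [e7W_negY] at hσY
    rw [hσX, hσY] at hratioσ
    exact e7_caseA hX0 hratio hratioσ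
  · -- Case B: `σP = T + (−P)`, the chord through `T = (0,0)`: `σX·X = −343`, `σY·X = Y·σX`
    left
    have hTP : WeierstrassCurve.Affine.Point.map σ' P = T + -P := by
      rw [← hTcase]; abel
    rw [hmapP, hP, hT, WeierstrassCurve.Affine.Point.neg_some,
      WeierstrassCurve.Affine.Point.add_of_X_ne (show (0 : K) ≠ X from hX0.symm)] at hTP
    obtain ⟨hσX, hσY⟩ := WeierstrassCurve.Affine.Point.some.inj hTP
    rw [WeierstrassCurve.Affine.slope_of_X_ne (show (0 : K) ≠ X from hX0.symm), e7W_negY] at hσX hσY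
    rw [e7W_addX] at hσX
    rw [e7W_addY] at hσY
    -- `σX · X = −343`
    have hℓ : (0 - -Y) / (0 - X) = -(Y / X) := by
      field_simp
      ring
    rw [hℓ] at hσX hσY
    have hσXX : σ X * X = -343 := by
      have e : ((-(Y / X)) ^ 2 - 294 - 0 - X) * X = (Y ^ 2 - 294 * X ^ 2 - X ^ 3) / X := by
        field_simp
        ring
      rw [hσX, e, hW]
      field_simp
      ring
    have hσX0 : σ X ≠ 0 := by
      intro h0; rw [h0, zero_mul] at hσXX; norm_num at hσXX
    have hσYX : σ Y * X = Y * σ X := by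
      rw [hσY, hσX]
      field_simp
      ring
    exact e7_caseB hX0 hσX0 hratio hratioσ hσYX

/-- **`CertB3E7` (stmt-Langlands-23416, sheet 4.5) with the Mordell–Weil input in FIXED-POINT form**:
typ-2's `certB3E7` (p670569) with `hE49` (stub `MordellWeilE7`) DISCHARGED to the weaker `hMW` by
`mordellWeilE7_of_fixedPoints`; `hK1`, `hZmm`, `hZmi` unchanged.  CONDITIONAL on the four named
inputs; «a certified finite datum is not a modularity statement». [cite: FreitasLeHungSiksek2015, Lemma 4.2 (arXiv:1310.7088 p. 28)] -/
theorem certB3E7_of_modelIdentification_of_fixedPoints_of_census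
    (hK1 : ∀ (K : Type) [Field K] [NumberField K], Module.finrank ℚ K = 4 → (∃ r : K, r ^ 2 = 5) →
        ∀ E : WeierstrassCurve (NumberField.RingOfIntegers K), E.Δ ≠ 0 →
          (∃ ρ : Literature.NumberTheory.GaloisRepresentations.FramedGaloisRep K (ZMod 3) 2, (∃ e : (E.baseChange K).geomTorsion ((3 : ℕ) : ℤ) ≃+ (Fin 2 → ZMod 3), ∀ (σ : Field.absoluteGaloisGroup K) (P : (E.baseChange K).geomTorsion ((3 : ℕ) : ℤ)), e (σ • P) = ((ρ σ : GL (Fin 2) (ZMod 3)) : Matrix (Fin 2) (Fin 2) (ZMod 3)) *ᵥ (e P)) ∧ ((∀ σ : Field.absoluteGaloisGroup K, (((ρ σ : GL (Fin 2) (ZMod 3)) : Matrix (Fin 2) (Fin 2) (ZMod 3)) 1 0 = 0)))) →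
          (∃ ρ : Literature.NumberTheory.GaloisRepresentations.FramedGaloisRep K (ZMod 7) 2, (∃ e : (E.baseChange K).geomTorsion ((7 : ℕ) : ℤ) ≃+ (Fin 2 → ZMod 7), ∀ (σ : Field.absoluteGaloisGroup K) (P : (E.baseChange K).geomTorsion ((7 : ℕ) : ℤ)), e (σ • P) = ((ρ σ : GL (Fin 2) (ZMod 7)) : Matrix (Fin 2) (Fin 2) (ZMod 7)) *ᵥ (e P)) ∧ ((∀ σ : Field.absoluteGaloisGroup K, (ρ σ : GL (Fin 2) (ZMod 7)) ∈ Subgroup.closure ({(⟨!![0, 5; 3, 0], !![0, 5; 3, 0], by decide, by decide⟩ : GL (Fin 2) (ZMod 7)), (⟨!![5, 0; 3, 2], !![3, 0; 6, 4], by decide, by decide⟩ : GL (Fin 2) (ZMod 7))} : Set (GL (Fin 2) (ZMod 7)))))) →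
          ((E.baseChange K).c₄ ^ 3 = 1728 * (E.baseChange K).Δ ∨
           ∃ x₁ y₁ x₂ y₂ : K, y₁ ^ 2 = 7 * (16 * x₁ ^ 4 + 68 * x₁ ^ 3 + 111 * x₁ ^ 2 + 62 * x₁ + 11) ∧ y₂ ^ 2 = 7 * (16 * x₂ ^ 4 + 68 * x₂ ^ 3 + 111 * x₂ ^ 2 + 62 * x₂ + 11) ∧
            ((x₁ ^ 3 + x₁ ^ 2 - 2 * x₁ - 1) ^ 7) ≠ 0 ∧
            (E.baseChange K).c₄ ^ 3 * ((x₁ ^ 3 + x₁ ^ 2 - 2 * x₁ - 1) ^ 7) = ((3 * x₁ + 1) ^ 3 * (4 * x₁ ^ 2 + 5 * x₁ + 2) ^ 3 * (x₁ ^ 2 + 3 * x₁ + 4) ^ 3 * (x₁ ^ 2 + 10 * x₁ + 4) ^ 3) * (E.baseChange K).Δ ∧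
            ((3 * x₂ ^ 2 + 6 * x₂ + 2) ^ 2 * x₁ ^ 4 + (36 * x₂ ^ 4 + 125 * x₂ ^ 3 + 138 * x₂ ^ 2 + 60 * x₂ + 9) * x₁ ^ 3 + (48 * x₂ ^ 4 + 138 * x₂ ^ 3 + 111 * x₂ ^ 2 + 33 * x₂ + 3) * x₁ ^ 2 + (24 * x₂ ^ 4 + 60 * x₂ ^ 3 + 33 * x₂ ^ 2 + 5 * x₂) * x₁ + (4 * x₂ ^ 4 + 9 * x₂ ^ 3 + 3 * x₂ ^ 2)) = 0))
    (hMW : ∀ (K : Type) [Field K] [NumberField K], Module.finrank ℚ K = 4 → ∀ r : K, r ^ 2 = 5 →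
        ∀ σ : K →+* K, σ r = r → σ ≠ RingHom.id K →
          ∀ X Y : K, σ X = X → σ Y = Y → Y ^ 2 = X ^ 3 + 294 * X ^ 2 - 343 * X → X = 0 ∧ Y = 0)
    (hZmm : ∀ (K : Type) [Field K] [NumberField K], Module.finrank ℚ K = 4 → (∃ r : K, r ^ 2 = 5) →
        ∀ x₁ y₁ x₂ x₁' x₂' : K, y₁ ^ 2 = 7 * (16 * x₁ ^ 4 + 68 * x₁ ^ 3 + 111 * x₁ ^ 2 + 62 * x₁ + 11) →
          ((3 * x₂ ^ 2 + 6 * x₂ + 2) ^ 2 * x₁ ^ 4 + (36 * x₂ ^ 4 + 125 * x₂ ^ 3 + 138 * x₂ ^ 2 + 60 * x₂ + 9) * x₁ ^ 3 + (48 * x₂ ^ 4 + 138 * x₂ ^ 3 + 111 * x₂ ^ 2 + 33 * x₂ + 3) * x₁ ^ 2 + (24 * x₂ ^ 4 + 60 * x₂ ^ 3 + 33 * x₂ ^ 2 + 5 * x₂) * x₁ + (4 * x₂ ^ 4 + 9 * x₂ ^ 3 + 3 * x₂ ^ 2)) = 0 →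
          (12 * x₁ + 5) * x₁' = -(5 * x₁ + 2) → (12 * x₂ + 5) * x₂' = -(5 * x₂ + 2) →
          ((3 * x₂' ^ 2 + 6 * x₂' + 2) ^ 2 * x₁' ^ 4 + (36 * x₂' ^ 4 + 125 * x₂' ^ 3 + 138 * x₂' ^ 2 + 60 * x₂' + 9) * x₁' ^ 3 + (48 * x₂' ^ 4 + 138 * x₂' ^ 3 + 111 * x₂' ^ 2 + 33 * x₂' + 3) * x₁' ^ 2 + (24 * x₂' ^ 4 + 60 * x₂' ^ 3 + 33 * x₂' ^ 2 + 5 * x₂') * x₁' + (4 * x₂' ^ 4 + 9 * x₂' ^ 3 + 3 * x₂' ^ 2)) = 0 →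
          (3 * x₁ + 1 = 0 ∨ x₁ ^ 2 + 10 * x₁ + 4 = 0))
    (hZmi : ∀ (K : Type) [Field K] [NumberField K], Module.finrank ℚ K = 4 → (∃ r : K, r ^ 2 = 5) →
        ∀ x₁ y₁ x₂ x₁' : K, y₁ ^ 2 = 7 * (16 * x₁ ^ 4 + 68 * x₁ ^ 3 + 111 * x₁ ^ 2 + 62 * x₁ + 11) →
          ((3 * x₂ ^ 2 + 6 * x₂ + 2) ^ 2 * x₁ ^ 4 + (36 * x₂ ^ 4 + 125 * x₂ ^ 3 + 138 * x₂ ^ 2 + 60 * x₂ + 9) * x₁ ^ 3 + (48 * x₂ ^ 4 + 138 * x₂ ^ 3 + 111 * x₂ ^ 2 + 33 * x₂ + 3) * x₁ ^ 2 + (24 * x₂ ^ 4 + 60 * x₂ ^ 3 + 33 * x₂ ^ 2 + 5 * x₂) * x₁ + (4 * x₂ ^ 4 + 9 * x₂ ^ 3 + 3 * x₂ ^ 2)) = 0 →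
          (12 * x₁ + 5) * x₁' = -(5 * x₁ + 2) →
          ((3 * x₂ ^ 2 + 6 * x₂ + 2) ^ 2 * x₁' ^ 4 + (36 * x₂ ^ 4 + 125 * x₂ ^ 3 + 138 * x₂ ^ 2 + 60 * x₂ + 9) * x₁' ^ 3 + (48 * x₂ ^ 4 + 138 * x₂ ^ 3 + 111 * x₂ ^ 2 + 33 * x₂ + 3) * x₁' ^ 2 + (24 * x₂ ^ 4 + 60 * x₂ ^ 3 + 33 * x₂ ^ 2 + 5 * x₂) * x₁' + (4 * x₂ ^ 4 + 9 * x₂ ^ 3 + 3 * x₂ ^ 2)) = 0 →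
          3 * x₁ + 1 = 0) :
    CertB3E7 :=
  certB3E7 hK1 (mordellWeilE7_of_fixedPoints hMW) hZmm hZmi

/-! ### §5 Anchor: `W ≅ 49a4` over `ℚ` -/

/-- `(u, r, s, t) = (2, −99, 1, 0)` takes `W = [0, 294, 0, −343, 0]` to Cremona/LMFDB
`49a4 = [1, −1, 0, −1822, 30393]` (the five standard `uⁱ·aᵢ' = …` identities) and `T = (0,0)` to
`x' = 99/4` — certnum's generator `(99/4, −99/8)` (RELEASES l.140 K2 TORE). [folklore] -/
theorem e7_W_variableChange_49a4 :
    (2 : ℚ) * 1 = 0 + 2 * 1 ∧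
    (2 : ℚ) ^ 2 * (-1) = 294 - 1 * 0 + 3 * (-99) - 1 ^ 2 ∧
    (2 : ℚ) ^ 3 * 0 = 0 + (-99) * 0 + 2 * 0 ∧
    (2 : ℚ) ^ 4 * (-1822) = -343 - 1 * 0 + 2 * (-99) * 294 - (0 + (-99) * 1) * 0 + 3 * (-99) ^ 2 - 2 * 1 * 0 ∧
    (2 : ℚ) ^ 6 * 30393 = 0 + (-99) * (-343) + (-99) ^ 2 * 294 + (-99) ^ 3 - 0 * 0 - 0 ^ 2 - (-99) * 0 * 0 ∧
    ((0 : ℚ) - (-99)) / 2 ^ 2 = 99 / 4 := by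
  norm_num

end Summit.Langlands.Langlands.Theorems.SqrtFiveQuarticCovers

end
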